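import Literature.Algebra.Homology.KunnethMapIso
import Mathlib.Algebra.Category.ModuleCat.Products
import HarnessLib

/-!
# The Künneth isomorphism in direct-sum form: `Hⁿ(C ⊗ D) ≃ₗ[k] ⨁_{i+j=n} Hⁱ(C) ⊗ₖ Hʲ(D)`

Layer `Literature/Algebra/Homology` (sequel of `Algebra/Homology/KunnethMapIso`; two definitions — the identification of
the degree-`n` term of a tensor product of complexes of modules with the explicit direct sum, and the packaged
`k`-linear Künneth equivalence —, 0 named facts, no instances, no notation).

Mathlib's `(HomologicalComplex.tensorObj K L).X n` is the categorical coproduct in `ModuleCat R` of the `Kⁱ ⊗ Lʲ` over the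
pairs with `i + j = n` (a total-complex term). For statements in the vocabulary of `DirectSum` / `TensorProduct` of
`R`-modules (the shape `⨁ (i : {i : ℤ × ℤ // i.1 + i.2 = n}), Kⁱ ⊗[R] Lʲ` in which Künneth-type statements are
usually typed elsewhere in the tree) we give:

* `TensorSummand`, `TensorDirectSum` (the types `Kⁱ ⊗_R Lʲ`, `⨁_{i+j=n} Kⁱ ⊗_R Lʲ`), `lofHom`;
  **`tensorObjXIsoDirectSum K L n : (K ⊗ L)ⁿ ≅ ModuleCat.of R (⨁ (p : {p : ℤ × ℤ // p.1 + p.2 = n}), K.X p.1.1 ⊗[R] L.X p.1.2)`**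
  (mutually inverse `mapBifunctorDesc (lof)` and `DirectSum.toModule (ιTensorObj)`), with `ιTensorObj_tensorObjXIsoDirectSum_hom`,
  `tensorObjXIsoDirectSum_inv_lof`;
* **`kunnethLinearEquiv C D a₁ b₁ a₂ b₂ n : (⨁ (p : {p : ℤ × ℤ // p.1 + p.2 = n}), Hᵖ¹(C) ⊗[k] Hᵖ²(D)) ≃ₗ[k] Hⁿ(C ⊗ D)`** for
  bounded cochain complexes of vector spaces over a field `k` (Weibel Thm. 3.6.3 in the direct-sum form; the categorical form
  is `KunnethMapIso.kunnethIso`), with **`kunnethLinearEquiv_lof : e (lof p x) = κ_{p₁,p₂} x`** (`[z] ⊗ [w] ↦ [z ⊗ w]`).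

Everything is proved; no named fact. Library only (cell `pub-hodge-ring2`, count-neutral homological algebra; proves nothing
about any crux, route or conjecture; no `Ext`-groups of sheaves are touched here).

## References

* C. A. Weibel, *An introduction to homological algebra* (1994), Thm. 3.6.3. [Weibel1994]
* H. Cartan, S. Eilenberg, *Homological Algebra* (1956), VI.3, Thm. 3.1. [CartanEilenberg1956]
-/

noncomputable section

-- `GradedObject`/`HomologicalComplex₂.toGradedObject` are not reducible (as in Mathlib's `Algebra/Homology/TotalComplex.lean`).
set_option backward.isDefEq.respectTransparency false

open CategoryTheory CategoryTheory.Category CategoryTheory.Limits CategoryTheory.MonoidalCategory HomologicalComplex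
open scoped DirectSum TensorProduct

universe u

namespace Literature.Algebra.Homology

/-! ### §1 The degree-`n` term of `K ⊗ L` as an explicit direct sum -/

section Term

variable {R : Type u} [CommRing R] (K L : CochainComplex (ModuleCat.{u} R) ℤ) (n : ℤ)

/-- The summand `Kⁱ ⊗_R Lʲ` indexed by a pair `p = (i, j)` with `i + j = n` (a type of `R`-modules).
[cite: Weibel1994, 2.7.1 and Thm. 3.6.3] -/
abbrev TensorSummand (p : {p : ℤ × ℤ // p.1 + p.2 = n}) : Type u := ↥(K.X p.1.1) ⊗[R] ↥(L.X p.1.2)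

/-- The explicit direct sum `⨁_{i+j=n} Kⁱ ⊗_R Lʲ` (a type of `R`-modules). [cite: Weibel1994, 2.7.1 and Thm. 3.6.3] -/
abbrev TensorDirectSum : Type u := ⨁ (p : {p : ℤ × ℤ // p.1 + p.2 = n}), TensorSummand K L n p

/-- The inclusion `Kⁱ ⊗ Lʲ ⟶ ⨁_{i+j=n} Kⁱ ⊗ Lʲ` of the summand `(i, j)`, as a morphism of `ModuleCat R`.
[cite: Weibel1994, Thm. 3.6.3] -/
def lofHom (i j : ℤ) (h : i + j = n) : K.X i ⊗ L.X j ⟶ ModuleCat.of R (TensorDirectSum K L n) :=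
  ModuleCat.ofHom (DirectSum.lof R {p : ℤ × ℤ // p.1 + p.2 = n} (TensorSummand K L n) ⟨(i, j), h⟩)

/-- `lofHom` on elements is `DirectSum.lof`. [cite: Weibel1994, Thm. 3.6.3] -/
theorem lofHom_apply (i j : ℤ) (h : i + j = n) (x : ↥(K.X i) ⊗[R] ↥(L.X j)) :
    lofHom K L n i j h x = DirectSum.lof R {p : ℤ × ℤ // p.1 + p.2 = n} (TensorSummand K L n) ⟨(i, j), h⟩ x := rfl

/-- `(K ⊗ L)ⁿ → ⨁_{i+j=n} Kⁱ ⊗ Lʲ`: on the summand `Kⁱ ⊗ Lʲ` it is the inclusion `lof (i, j)`. [cite: Weibel1994, Thm. 3.6.3] -/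
def tensorObjXToDirectSum : (HomologicalComplex.tensorObj K L).X n ⟶ ModuleCat.of R (TensorDirectSum K L n) :=
  mapBifunctorDesc fun i j (h : ComplexShape.π (ComplexShape.up ℤ) (ComplexShape.up ℤ) (ComplexShape.up ℤ) (i, j) = n) =>
    lofHom K L n i j h

/-- `⨁_{i+j=n} Kⁱ ⊗ Lʲ → (K ⊗ L)ⁿ`: on the summand `(i, j)` it is `ιTensorObj`. [cite: Weibel1994, Thm. 3.6.3] -/
def directSumToTensorObjX : ModuleCat.of R (TensorDirectSum K L n) ⟶ (HomologicalComplex.tensorObj K L).X n :=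
  ModuleCat.ofHom (DirectSum.toModule R {p : ℤ × ℤ // p.1 + p.2 = n} _ fun p => (ιTensorObj K L p.1.1 p.1.2 n p.2).hom)

/-- `ι_{i,j} ≫ tensorObjXToDirectSum = lof (i, j)`. [cite: Weibel1994, Thm. 3.6.3] -/
@[reassoc]
theorem ιTensorObj_tensorObjXToDirectSum (i j : ℤ) (h : i + j = n) :
    ιTensorObj K L i j n h ≫ tensorObjXToDirectSum K L n = lofHom K L n i j h := by
  unfold tensorObjXToDirectSum
  exact HomologicalComplex.ι_mapBifunctorDesc _ i j h

/-- `directSumToTensorObjX (lof (i, j) x) = ι_{i,j} x`. [cite: Weibel1994, Thm. 3.6.3] -/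
theorem directSumToTensorObjX_lof (p : {p : ℤ × ℤ // p.1 + p.2 = n}) (x : TensorSummand K L n p) :
    directSumToTensorObjX K L n (DirectSum.lof R _ (TensorSummand K L n) p x) = ιTensorObj K L p.1.1 p.1.2 n p.2 x := by
  change DirectSum.toModule R _ _ _ (DirectSum.lof R _ _ p x) = _
  rw [DirectSum.toModule_lof]
  rfl

/-- **`(K ⊗ L)ⁿ ≅ ⨁_{i+j=n} Kⁱ ⊗_R Lʲ`** — Mathlib's total-complex term (a categorical coproduct in `ModuleCat R`) identified with
the explicit direct sum of tensor products of modules. [cite: Weibel1994, 2.7.1 and Thm. 3.6.3] -/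
def tensorObjXIsoDirectSum : (HomologicalComplex.tensorObj K L).X n ≅ ModuleCat.of R (TensorDirectSum K L n) where
  hom := tensorObjXToDirectSum K L n
  inv := directSumToTensorObjX K L n
  hom_inv_id := by
    apply mapBifunctor.hom_ext
    intro i j h
    rw [ιTensorObj_tensorObjXToDirectSum_assoc, comp_id]
    ext x
    change directSumToTensorObjX K L n (lofHom K L n i j h x) = _
    rw [lofHom_apply]
    exact directSumToTensorObjX_lof K L n ⟨(i, j), h⟩ x
  inv_hom_id := by
    ext1
    refine DirectSum.linearMap_ext R fun p => LinearMap.ext fun x => ?_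
    change tensorObjXToDirectSum K L n (directSumToTensorObjX K L n (DirectSum.lof R _ _ p x)) = DirectSum.lof R _ _ p x
    rw [directSumToTensorObjX_lof]
    obtain ⟨⟨i, j⟩, h⟩ := p
    have e := ιTensorObj_tensorObjXToDirectSum K L n i j h
    exact (congrArg (fun φ : K.X i ⊗ L.X j ⟶ ModuleCat.of R (TensorDirectSum K L n) => φ x) e).trans
      (lofHom_apply K L n i j h x)

/-- `ι_{i,j} ≫ (iso).hom = lof (i, j)`. [cite: Weibel1994, Thm. 3.6.3] -/
@[reassoc]
theorem ιTensorObj_tensorObjXIsoDirectSum_hom (i j : ℤ) (h : i + j = n) :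
    ιTensorObj K L i j n h ≫ (tensorObjXIsoDirectSum K L n).hom = lofHom K L n i j h :=
  ιTensorObj_tensorObjXToDirectSum K L n i j h

/-- `(iso).inv (lof p x) = ι_p x`. [cite: Weibel1994, Thm. 3.6.3] -/
theorem tensorObjXIsoDirectSum_inv_lof (p : {p : ℤ × ℤ // p.1 + p.2 = n}) (x : TensorSummand K L n p) :
    (tensorObjXIsoDirectSum K L n).inv (DirectSum.lof R _ (TensorSummand K L n) p x) = ιTensorObj K L p.1.1 p.1.2 n p.2 x :=
  directSumToTensorObjX_lof K L n p x

end Term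

/-! ### §2 The Künneth isomorphism in direct-sum form over a field -/

section Field

variable {k : Type u} [Field k] (C D : CochainComplex (ModuleCat.{u} k) ℤ) (a₁ b₁ a₂ b₂ : ℤ) [C.IsStrictlyGE a₁]
  [C.IsStrictlyLE b₁] [D.IsStrictlyGE a₂] [D.IsStrictlyLE b₂] (n : ℤ)

/-- **The Künneth theorem over a field, direct-sum form** (Weibel Thm. 3.6.3): for bounded cochain complexes `C`, `D` of
`k`-vector spaces, `⨁_{i+j=n} Hⁱ(C) ⊗ₖ Hʲ(D) ≃ₗ[k] Hⁿ(C ⊗ D)`, the sum of the cross products `[z] ⊗ [w] ↦ [z ⊗ w]`.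
[cite: Weibel1994, Thm. 3.6.3] [cite: CartanEilenberg1956, VI.3 Thm. 3.1] -/
def kunnethLinearEquiv :
    TensorDirectSum (homologyZeroDifferential C) (homologyZeroDifferential D) n ≃ₗ[k]
      (HomologicalComplex.tensorObj C D).homology n :=
  ((tensorObjXIsoDirectSum (homologyZeroDifferential C) (homologyZeroDifferential D) n).symm ≪≫
    kunnethIso C D a₁ b₁ a₂ b₂ n).toLinearEquiv

/-- The source of `kunnethLinearEquiv` is literally `⨁ (p : {p : ℤ × ℤ // p.1 + p.2 = n}), Hᵖ¹(C) ⊗[k] Hᵖ²(D)` (`rfl`).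
[cite: Weibel1994, Thm. 3.6.3] -/
theorem tensorDirectSum_homologyZeroDifferential :
    TensorDirectSum (homologyZeroDifferential C) (homologyZeroDifferential D) n =
      (⨁ (p : {p : ℤ × ℤ // p.1 + p.2 = n}), (↥(C.homology p.1.1) ⊗[k] ↥(D.homology p.1.2))) := rfl

/-- **On the summand `(i, j)` the Künneth equivalence is the cross product `κᵢⱼ : [z] ⊗ [w] ↦ [z ⊗ w]`.**
[cite: Weibel1994, Thm. 3.6.3] -/
theorem kunnethLinearEquiv_lof (p : {p : ℤ × ℤ // p.1 + p.2 = n})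
    (x : TensorSummand (homologyZeroDifferential C) (homologyZeroDifferential D) n p) :
    kunnethLinearEquiv C D a₁ b₁ a₂ b₂ n
        (DirectSum.lof k _ (TensorSummand (homologyZeroDifferential C) (homologyZeroDifferential D) n) p x) =
      kunnethComponent C D p.1.1 p.1.2 n p.2 x := by
  change (kunnethIso C D a₁ b₁ a₂ b₂ n).hom
      ((tensorObjXIsoDirectSum (homologyZeroDifferential C) (homologyZeroDifferential D) n).inv
        (DirectSum.lof k _ _ p x)) = _
  rw [tensorObjXIsoDirectSum_inv_lof]
  exact congrArg (fun φ : (homologyZeroDifferential C).X p.1.1 ⊗ (homologyZeroDifferential D).X p.1.2 ⟶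
      (HomologicalComplex.tensorObj C D).homology n => φ x) (ι_kunnethIso_hom C D a₁ b₁ a₂ b₂ p.1.1 p.1.2 n p.2)

include a₁ b₁ a₂ b₂ in
/-- **Vanishing corollary**: `Hⁿ(C ⊗ D)` vanishes as soon as every `Hⁱ(C) ⊗ Hʲ(D)` with `i + j = n` does (e.g.
`H•(D) = 0`). [cite: Weibel1994, Thm. 3.6.3] -/
theorem subsingleton_homology_tensorObj_of_forall
    (h : ∀ p : {p : ℤ × ℤ // p.1 + p.2 = n}, Subsingleton (↥(C.homology p.1.1) ⊗[k] ↥(D.homology p.1.2))) :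
    Subsingleton ((HomologicalComplex.tensorObj C D).homology n) := by
  haveI : ∀ p : {p : ℤ × ℤ // p.1 + p.2 = n},
      Subsingleton (TensorSummand (homologyZeroDifferential C) (homologyZeroDifferential D) n p) := h
  exact (kunnethLinearEquiv C D a₁ b₁ a₂ b₂ n).symm.toEquiv.subsingleton

end Field

end Literature.Algebra.Homology

end
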